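import Summits.QuantumFields.YangMills.Theorems.SwapVirialDeficitSharpSwapLaplaceOfVolumeLaw
import Summits.QuantumFields.YangMills.Theorems.SwapVirialDeficitSwapRingSectorPairing
import HarnessLib

/-!
# Route `SwapVirialDeficit` (YangMills): the sharp σ-glued small-ball law is needed for ONE sector class
# (crux ⟨stmt-QuantumFields-24197⟩ `SwapVirialDeficit.SwapGluedStiffness`; LEAD g93's ruling 07:46Z «the principal-class SHARP law + the sector
# triage»; interface between w2 g55's ✓`SwapRing.measureReal_swapDeficit_le_sliceFlip` (C-a) and ✓`swapGluedStiffness_of_sharpSwapVolumeLaw`)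

The pairing `z ↦ z + (1,1,0)` (the slice flip, an EXACT symmetry of the ring measure, ✓`measureReal_swapDeficit_le_sliceFlip`) folds the mixed
σ-glued state density onto the four classes with `z 0 = 0` (§1 `mixedDensity_eq_quarter_sum_filter`:
`(1/8)Σ_z μ_L{F^S_z ≤ t} = (1/4)Σ_{z 0 = 0} μ_L{F^S_z ≤ t}`).  Hence (§2) the hypothesis `SharpSwapVolumeLaw` of
✓`swapGluedStiffness_of_sharpSwapVolumeLaw` follows — with `v ↦ v/4`, `K₁ ↦ 4K₁ + 2` — from
* (P) the SHARP law for the PRINCIPAL class alone: `μ_L{F^S_{000} ≤ t} = v(L)·t^{9L⁴−1}·(1 ± K₁L^{q₁}t^θ)` on `(0,(K₁L^{q₁})⁻¹]`, `|log v(L)| ≤ K₁L^{q₁}`;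
* (S) uniform RELATIVE SMALLNESS of the three other classes `z ∈ {010, 001, 011}`: `μ_L{F^S_z ≤ t} ≤ K₁L^{q₁}t^θ·v(L)t^{9L⁴−1}` on the same range
  (at fixed `L`: w2 g55's (C-b)/(C-c) — odd classes void near the valley, minus classes `O(√t)`-subleading);
★★ `sharpSwapVolumeLaw_of_principalClass`, ★★★ `swapGluedStiffness_of_principalClassSharpLaw : (P ∧ S) → Theses.SwapVirialDeficit.SwapGluedStiffness`.
HONEST FRAMING: conditional bookkeeping; (P), (S), the heart `SharpSwapLaplace`, ⟨24197⟩, ⟨24194⟩ and every rung / summit statement stay OPEN; the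
Yang–Mills mass gap is NOT proved; no summit is proved by a line.  THEOREMS ONLY (0 `def`, 0 `sorry`), standard axioms.
Seat ym-line-fcl-p3 g43 (cell ym-idea-1, free hands), `--supports stmt-QuantumFields-24197`.  References: [cite: tHooft1979]; [cite: Griffiths1964];
[cite: Luscher1983, §2].
-/

set_option autoImplicit false

noncomputable section

namespace Summit.QuantumFields.YangMills.Theorems.SwapVirialDeficit.SharpSigma

open MeasureTheory Set
open scoped BigOperators
open Summit.QuantumFields.YangMills.Theorems.FemtoTransferGap
open Summit.QuantumFields.YangMills.Theorems.VirialFluxGap.RingDeficit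
open Summit.QuantumFields.YangMills.Theorems.SwapVirialDeficit.SwapRing

variable {L : ℕ} [NeZero L]

/-! ## §1 The mixed state density over the four sector classes -/

/-- ★ **`(1/8)Σ_z μ_L{F^S_z ≤ t} = (1/4)Σ_{z : z 0 = 0} μ_L{F^S_z ≤ t}`** — the sector sum folded along the pairing `z ↦ z + (1,1,0)`
(✓`measureReal_swapDeficit_le_sliceFlip`; the proof of ✓`twistTrace_eq_quarter_sum_filter` verbatim for state densities). [cite: tHooft1979] -/
theorem mixedDensity_eq_quarter_sum_filter (t : ℝ) :
    (1 / 8 : ℝ) * ∑ z : Fin 3 → Bool, (ringMeasure L).real {P | swapRingDeficit L z P ≤ t} =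
      (1 / 4 : ℝ) * ∑ z ∈ (Finset.univ : Finset (Fin 3 → Bool)).filter (fun z => z 0 = false),
        (ringMeasure L).real {P | swapRingDeficit L z P ≤ t} := by
  set f : (Fin 3 → Bool) → ℝ := fun z => (ringMeasure L).real {P | swapRingDeficit L z P ≤ t} with hf
  have hsplit := (Finset.sum_filter_add_sum_filter_not (Finset.univ : Finset (Fin 3 → Bool)) (fun z => z 0 = false) f).symm
  have hfold : ∑ z ∈ (Finset.univ : Finset (Fin 3 → Bool)).filter (fun z => ¬ z 0 = false), f z =
      ∑ z ∈ (Finset.univ : Finset (Fin 3 → Bool)).filter (fun z => z 0 = false), f z := by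
    refine Finset.sum_nbij' (fun z k => Bool.xor (z k) (decide (k ≠ 2))) (fun z k => Bool.xor (z k) (decide (k ≠ 2))) ?_ ?_ ?_ ?_ ?_
    · intro z hz
      simp only [Finset.mem_filter, Finset.mem_univ, true_and] at hz ⊢
      cases h : z 0 <;> simp_all
    · intro z hz
      simp only [Finset.mem_filter, Finset.mem_univ, true_and] at hz ⊢
      simp [hz]
    · intro z _; exact xor_ne_two_xor_ne_two z
    · intro z _; exact xor_ne_two_xor_ne_two z
    · intro z _
      simp only [hf]
      rw [measureReal_swapDeficit_le_sliceFlip]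
  change (1 / 8 : ℝ) * ∑ z : Fin 3 → Bool, f z = (1 / 4 : ℝ) * ∑ z ∈ (Finset.univ : Finset (Fin 3 → Bool)).filter (fun z => z 0 = false), f z
  rw [hsplit, hfold, ← two_mul]
  ring

omit [NeZero L] in
/-- The principal label lies in the class `z 0 = 0`, whose other three members are `≠ 0`. [folklore] -/
theorem zero_mem_filter : (fun _ : Fin 3 => false) ∈ (Finset.univ : Finset (Fin 3 → Bool)).filter (fun z => z 0 = false) := by
  simp

omit [NeZero L] in
/-- The class `z 0 = 0` has four members. [folklore] -/
theorem card_filter_eq_four : ((Finset.univ : Finset (Fin 3 → Bool)).filter (fun z => z 0 = false)).card = 4 := by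
  decide

/-! ## §2 From the principal class to the mixed law, and to the crux -/

/-- ★★ **`SharpSwapVolumeLaw` from the principal class**: the sharp law (P) for `z = 0` and the relative smallness (S) of the classes
`010, 001, 011` give the sharp law of the mixed σ-glued state density with `v ↦ v/4`, `K₁ ↦ 4K₁ + 2`. [cite: tHooft1979] [cite: Griffiths1964] -/
theorem sharpSwapVolumeLaw_of_principalClass
    (hP : ∃ K₁ : ℝ, 0 < K₁ ∧ ∃ q₁ : ℝ, 0 ≤ q₁ ∧ ∃ θ : ℝ, 0 < θ ∧ θ ≤ 1 ∧ ∃ v : ℕ → ℝ, ∃ L₀ : ℕ,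
      ∀ (L : ℕ) [NeZero L], L₀ ≤ L → 0 < v L ∧ |Real.log (v L)| ≤ K₁ * (L : ℝ) ^ q₁ ∧
        ∀ t : ℝ, 0 < t → t ≤ (K₁ * (L : ℝ) ^ q₁)⁻¹ →
          |(ringMeasure L).real {P | swapRingDeficit L (fun _ => false) P ≤ t} / (v L * t ^ (9 * L ^ 4 - 1)) - 1| ≤
              K₁ * (L : ℝ) ^ q₁ * t ^ θ ∧
            ∀ z : Fin 3 → Bool, z 0 = false → z ≠ (fun _ => false) →
              (ringMeasure L).real {P | swapRingDeficit L z P ≤ t} ≤ K₁ * (L : ℝ) ^ q₁ * t ^ θ * (v L * t ^ (9 * L ^ 4 - 1))) :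
    ∃ K₁ : ℝ, 0 < K₁ ∧ ∃ q₁ : ℝ, 0 ≤ q₁ ∧ ∃ θ : ℝ, 0 < θ ∧ θ ≤ 1 ∧ ∃ v : ℕ → ℝ, ∃ L₀ : ℕ,
      ∀ (L : ℕ) [NeZero L], L₀ ≤ L → 0 < v L ∧ |Real.log (v L)| ≤ K₁ * (L : ℝ) ^ q₁ ∧
        ∀ t : ℝ, 0 < t → t ≤ (K₁ * (L : ℝ) ^ q₁)⁻¹ →
          |((1 / 8 : ℝ) * ∑ z : Fin 3 → Bool, (ringMeasure L).real {P | swapRingDeficit L z P ≤ t}) / (v L * t ^ (9 * L ^ 4 - 1)) - 1| ≤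
            K₁ * (L : ℝ) ^ q₁ * t ^ θ := by
  obtain ⟨K₁, hK₁, q₁, hq₁, θ, hθ, hθ1, v, L₀, hV⟩ := hP
  refine ⟨4 * K₁ + 2, by positivity, q₁, hq₁, θ, hθ, hθ1, fun L => v L / 4, max L₀ 1, ?_⟩
  intro L _ hL
  have hL₀ : L₀ ≤ L := le_trans (le_max_left _ _) hL
  have hL1 : (1 : ℝ) ≤ (L : ℝ) := by exact_mod_cast le_trans (le_max_right _ _) hL
  have hL0 : (0 : ℝ) < (L : ℝ) := by linarith
  obtain ⟨hv, hlogv, hvol⟩ := hV L hL₀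
  have hLq : (1 : ℝ) ≤ (L : ℝ) ^ q₁ := Real.one_le_rpow hL1 hq₁
  set κ : ℝ := K₁ * (L : ℝ) ^ q₁ with hκ
  have hκ0 : 0 < κ := by positivity
  have hκ' : κ ≤ (4 * K₁ + 2) * (L : ℝ) ^ q₁ := by rw [hκ]; nlinarith
  refine ⟨by positivity, ?_, fun t ht htle => ?_⟩
  · -- `|log (v/4)| ≤ |log v| + log 4 ≤ (K₁ + 2) L^{q₁}`
    rw [Real.log_div hv.ne' (by norm_num)]
    have h4 : Real.log 4 ≤ 2 := by
      have := Real.log_le_sub_one_of_pos (by norm_num : (0:ℝ) < 4)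
      have h2 : Real.log 4 = 2 * Real.log 2 := by
        rw [show (4 : ℝ) = 2 ^ 2 by norm_num, Real.log_pow]; norm_num
      rw [h2]; linarith [Real.log_two_lt_d9]
    have h4' : 0 ≤ Real.log 4 := Real.log_nonneg (by norm_num)
    calc |Real.log (v L) - Real.log 4| ≤ |Real.log (v L)| + |Real.log 4| := abs_sub _ _
      _ ≤ κ + 2 := by rw [abs_of_nonneg h4']; exact add_le_add hlogv h4
      _ ≤ (4 * K₁ + 2) * (L : ℝ) ^ q₁ := by rw [hκ]; nlinarith
  · -- the range of (P)/(S) contains the new range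
    have htle' : t ≤ κ⁻¹ := htle.trans (inv_anti₀ hκ0 hκ')
    obtain ⟨hsharp, hsmall⟩ := hvol t ht htle'
    have hvt : 0 < v L * t ^ (9 * L ^ 4 - 1) := by positivity
    set S := (Finset.univ : Finset (Fin 3 → Bool)).filter (fun z => z 0 = false) with hS
    set m : (Fin 3 → Bool) → ℝ := fun z => (ringMeasure L).real {P | swapRingDeficit L z P ≤ t} with hm
    -- split the class sum into the principal term and the three others
    have hsplit : ∑ z ∈ S, m z = m (fun _ => false) + ∑ z ∈ S.erase (fun _ => false), m z :=
      (Finset.add_sum_erase S m zero_mem_filter).symm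
    have hcard : (S.erase (fun _ => false)).card = 3 := by
      rw [Finset.card_erase_of_mem zero_mem_filter, card_filter_eq_four]
    have hrest : ∑ z ∈ S.erase (fun _ => false), m z ≤ 3 * (κ * t ^ θ * (v L * t ^ (9 * L ^ 4 - 1))) := by
      have h : ∀ z ∈ S.erase (fun _ => false), m z ≤ κ * t ^ θ * (v L * t ^ (9 * L ^ 4 - 1)) := by
        intro z hz
        rw [Finset.mem_erase] at hz
        have hz0 : z 0 = false := by
          have := hz.2; rw [hS, Finset.mem_filter] at this; exact this.2
        exact hsmall z hz0 hz.1
      calc ∑ z ∈ S.erase (fun _ => false), m z ≤ ∑ _z ∈ S.erase (fun _ => false), κ * t ^ θ * (v L * t ^ (9 * L ^ 4 - 1)) :=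
            Finset.sum_le_sum h
        _ = 3 * (κ * t ^ θ * (v L * t ^ (9 * L ^ 4 - 1))) := by rw [Finset.sum_const, hcard]; simp
    have hrest0 : 0 ≤ ∑ z ∈ S.erase (fun _ => false), m z := Finset.sum_nonneg fun z _ => measureReal_nonneg
    -- the principal term
    have hup := (abs_sub_le_iff.1 hsharp).1
    have hlo := (abs_sub_le_iff.1 hsharp).2
    rw [sub_le_iff_le_add, div_le_iff₀ hvt] at hup
    rw [sub_le_comm, le_div_iff₀ hvt] at hlo
    -- the mixed density in terms of the class sum
    have hmix : (1 / 8 : ℝ) * ∑ z : Fin 3 → Bool, (ringMeasure L).real {P | swapRingDeficit L z P ≤ t} = (1 / 4 : ℝ) * ∑ z ∈ S, m z :=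
      mixedDensity_eq_quarter_sum_filter (L := L) t
    rw [hmix, hsplit]
    have hden : v L / 4 * t ^ (9 * L ^ 4 - 1) = (1 / 4 : ℝ) * (v L * t ^ (9 * L ^ 4 - 1)) := by ring
    rw [hden, mul_div_mul_left _ _ (by norm_num : (1 / 4 : ℝ) ≠ 0)]
    -- now `|(m₀ + rest)/(v t^N) − 1| ≤ 4κ t^θ ≤ (4K₁+2)L^{q₁} t^θ`
    have htθ : 0 ≤ t ^ θ := Real.rpow_nonneg ht.le _
    have hgoal : |(m (fun _ => false) + ∑ z ∈ S.erase (fun _ => false), m z) / (v L * t ^ (9 * L ^ 4 - 1)) - 1| ≤ 4 * κ * t ^ θ := by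
      rw [abs_sub_le_iff, sub_le_iff_le_add, div_le_iff₀ hvt, sub_le_comm, le_div_iff₀ hvt]
      constructor
      · nlinarith [hup, hrest, htθ, hvt]
      · nlinarith [hlo, hrest0, htθ, hvt]
    refine hgoal.trans ?_
    calc 4 * κ * t ^ θ = (4 * κ) * t ^ θ := by ring
      _ ≤ ((4 * K₁ + 2) * (L : ℝ) ^ q₁) * t ^ θ := mul_le_mul_of_nonneg_right (by rw [hκ]; nlinarith) htθ
      _ = (4 * K₁ + 2) * (L : ℝ) ^ q₁ * t ^ θ := by ring

/-- ★★★ **`(P) + (S) ⟹ SwapGluedStiffness` BY NAME**: the sharp small-ball law of the PRINCIPAL σ-sector class and the uniform relative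
smallness of the three other classes imply the route crux ⟨stmt-QuantumFields-24197⟩ (through ✓`sharpSwapVolumeLaw_of_principalClass` and
✓`swapGluedStiffness_of_sharpSwapVolumeLaw`). [cite: tHooft1979] [cite: Griffiths1964] -/
theorem swapGluedStiffness_of_principalClassSharpLaw
    (hP : ∃ K₁ : ℝ, 0 < K₁ ∧ ∃ q₁ : ℝ, 0 ≤ q₁ ∧ ∃ θ : ℝ, 0 < θ ∧ θ ≤ 1 ∧ ∃ v : ℕ → ℝ, ∃ L₀ : ℕ,
      ∀ (L : ℕ) [NeZero L], L₀ ≤ L → 0 < v L ∧ |Real.log (v L)| ≤ K₁ * (L : ℝ) ^ q₁ ∧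
        ∀ t : ℝ, 0 < t → t ≤ (K₁ * (L : ℝ) ^ q₁)⁻¹ →
          |(ringMeasure L).real {P | swapRingDeficit L (fun _ => false) P ≤ t} / (v L * t ^ (9 * L ^ 4 - 1)) - 1| ≤
              K₁ * (L : ℝ) ^ q₁ * t ^ θ ∧
            ∀ z : Fin 3 → Bool, z 0 = false → z ≠ (fun _ => false) →
              (ringMeasure L).real {P | swapRingDeficit L z P ≤ t} ≤ K₁ * (L : ℝ) ^ q₁ * t ^ θ * (v L * t ^ (9 * L ^ 4 - 1))) :
    Summit.QuantumFields.YangMills.Theses.SwapVirialDeficit.SwapGluedStiffness :=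
  swapGluedStiffness_of_sharpSwapVolumeLaw (sharpSwapVolumeLaw_of_principalClass hP)

end Summit.QuantumFields.YangMills.Theorems.SwapVirialDeficit.SharpSigma

end
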